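import Summits.AtomisticToContinuum.Crystallization.Theorems.ChartedZeroExcessLayeredLatticeLiouvilleZZZYM

/-!
# ChartedZeroExcess · LayeredLatticeLiouville ZZZYN (lens-2 g96 NODE 96 «LoadStep») — the cut of the a-priori piece (X2ᴸ′)

Docket `stmt-AtomisticToContinuum-26636`, W2 residual of record (critic r1663):
(X1ᴸ′) ∧ (X2ᴸ′) ∧ (KAᴸ′) ∧ (QL♯ᴸ′)(c > 0) ∧ (OGʰ′⋆)(g₀ > 0) ⟹ `[MCMC♮]` (door `mildCoherentMoatCorePG_W2m`, file ZZZYM).  The binding dial of the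
residual is the inner bond radius `sb₁` (SB1-PIN-95: the sharp ledger (QL♯ᴸ′) is certified for `sb₁ ≤ 1/400`), and `sb₁` is SUPPLIED by the
a-priori piece (X2ᴸ′) `LabelLoadedTubeAprioriP` alone — the one HEAVY · UNDECIDED piece of the residual with no typed statement beneath it.

THE LENS (structural dichotomy, special vs generic) applied to (X2ᴸ′).  The desk line E2 (memo NODE-g96 §1) shows that the plain
product `‖G_clamped‖_{∞→∞} · ‖φ₀‖_∞` FAILS the pass line by a factor 17–50 (the body-force Green operator of the clamped patch amplifies by `∝ R`),
while the STRUCTURED linear response (seam-supported incoherent `ε`-mismatch + layer-telescoping offset residual + `r⁻⁴` far field) is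
`≤ 1.5·10⁻³ < 1/400`; and that the one-shot Newton–Kantorovich argument in the bond-sup tube does NOT close at the label patch size (nonlinearity
constant `Σ_bonds |V‴|·|∇G| ≈ 1.5–4.5·10³ ∝ R`), whereas continuation in SMALL LOAD STEPS does.  This file types that structure:

* §1  bookkeeping (PROVED): the tube step lemma `bondTube_step` and LOADED uniqueness `eq_of_hasFDerivAt_eq_of_strongConvexOn` (tree YOA's
      `eq_of_hasFDerivAt_zero_of_strongConvexOn` transported to a nonzero common load);
* §2  the pieces (TYPED, binders of (X2ᴸ′) verbatim):
      (LSᴸ) `LabelLoadStepP … sb₁ dI₁ dB₁ ηb ηI ηB h …` — UNIFORM LOCAL LOAD-STEP SOLVABILITY in the inner tube: from a loaded critical point at load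
      `t` inside the `η`-shrunk inner tube, every load `s` with `|s − t| ≤ h` has a critical point within tube-distance `η` [ANALYTIC · LOCAL (an
      inverse-function statement) · INCOMPARABLE with (X2ᴸ′) as typed (local existence-with-bound instead of global confinement; neither gives the
      other without (X1ᴸ′)) · UNDECIDED(test = E2: the uniform response bound `Γ₁ ≈ 1.2–1.5·10⁻³` per unit load over the inner tube, `η ≈ Γ₁·h`)];
      (GRᴸ) `LabelGreenResponseP … sb₁ dI₁ dB₁ Γb ΓI ΓB …` — the UNIFORM LINEAR RESPONSE BOUND over the inner tube for the ACTUAL label load `φ₀`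
      (the object the desk line E2 computes at the tube centre; polarised `clampedHessForm`, no operator inverse) [ANALYTIC · LINEAR · UNDECIDED(E2) ·
      the typed home of «E2-AFF»: its proof is the seam/telescoping/far-field decomposition of `φ₀`, never the `∞→∞` product];
* §3  the glue (PROVED): `labelLoadedTubeAprioriP_of_loadStep : (X1ᴸ′)(lam > 0) ∧ (LSᴸ)(h = 1/m, (m+1)·η ≤ inner radii ≤ outer radii) ⟹ (X2ᴸ′)` —
      an `m`-step march `y₀ = z₀, z₁, …, z_m` of loaded critical points with `z_k ∈ tube(k·η)`, one more step to the given load, and LOADED UNIQUENESS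
      on the outer tube from (X1ᴸ′);
* §4  the door `mildCoherentMoatCorePG_W2n` : (X1ᴸ′)(lam > 0) ∧ (LSᴸ) ∧ (KAᴸ′) ∧ (QL♯ᴸ′)(c > 0) ∧ (OGʰ′⋆)(g₀ > 0) ⟹ `[MCMC♮]`, and a dial example
      (`m = 24`, `η = 10⁻⁴`, inner radii `1/400`).

(GRᴸ) is typed but NOT yet wired: (LSᴸ) ⟸ (GRᴸ)(Γ) ∧ (C2-type chord calculus on the inner tube) ∧ (Hessian–Lipschitz constant from `ljThirdDeriv`)
by Newton–Kantorovich at step `h ≤ 1/(4·Λ_nl·Γ)` is the next node (memo §4).  Same namespace as the docket; 2 `Prop` pieces + 4 theorems +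
1 example; 0 sorry. [g96]
-/

noncomputable section

open scoped BigOperators Classical InnerProductSpace RealInnerProductSpace
open MeasureTheory Set Metric Filter Topology
open Literature.MathematicalPhysics.StatisticalMechanics (lennardJones interactionEnergy)

namespace Summit.AtomisticToContinuum.Crystallization.Theorems.ChartedZeroExcessLayeredLatticeLiouville

open Summit.AtomisticToContinuum.Crystallization.Theorems.ChartedPlanarOrderRigidityDoor (E3 IsClean)
open Summit.AtomisticToContinuum.Crystallization.Theorems.ChartedPlanarOrderDensityDichotomy (μS IsSep)
open Summit.AtomisticToContinuum.Crystallization.Theorems.ChartedPlanarOrderCleanScaleP (IsCleanP IsDoorSetP)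
open Summit.AtomisticToContinuum.Crystallization.Theorems.ChartedPlanarOrderMesoCut (LayeredHom EnvClose)
open Summit.AtomisticToContinuum.Crystallization.Theorems.ChartedPlanarOrderDoorLayeredOsc (IsTwoShellAffineGood)

/-! ### ZZZYN-1  Bookkeeping: the tube step lemma and loaded uniqueness (PROVED) -/

section Bookkeeping

variable {n : ℕ} {X : Set E3} {Rg : ℝ} {y₀ : Fin n → E3}

/-- **THE TUBE STEP LEMMA**: if `y ∈ T(a)` and the INCREMENT `y′ − y`, re-based at the reference (`i ↦ y′ i − y i + y₀ i`), lies in `T(b)`, then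
`y′ ∈ T(a + b)` — bond deviations and pins add along a step. [this file, g96] -/
theorem bondTube_step {a₁ a₂ a₃ b₁ b₂ b₃ : ℝ} {y y' : Fin n → E3} (hy : y ∈ bondTube X Rg a₁ a₂ a₃ y₀)
    (hd : (fun i => y' i - y i + y₀ i) ∈ bondTube X Rg b₁ b₂ b₃ y₀) : y' ∈ bondTube X Rg (a₁ + b₁) (a₂ + b₂) (a₃ + b₃) y₀ := by
  obtain ⟨hb, hI, hB⟩ := mem_bondTube_iff.1 hy
  obtain ⟨hb', hI', hB'⟩ := mem_bondTube_iff.1 hd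
  refine mem_bondTube_iff.2 ⟨fun i j hij => ?_, fun i hi => ?_, fun i => ?_⟩
  · have h1 := hb i j hij
    have h2 := hb' i j hij
    rw [dist_eq_norm] at h1 h2 ⊢
    have e : y' i - y' j - (y₀ i - y₀ j) = (y i - y j - (y₀ i - y₀ j)) + (y' i - y i + y₀ i - (y' j - y j + y₀ j) - (y₀ i - y₀ j)) := by abel
    rw [e]
    exact (norm_add_le _ _).trans (add_le_add h1 h2)
  · have h1 := hI i hi
    have h2 := hI' i hi
    rw [dist_eq_norm] at h1 h2 ⊢
    have e : y' i - y₀ i = (y i - y₀ i) + (y' i - y i + y₀ i - y₀ i) := by abel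
    rw [e]
    exact (norm_add_le _ _).trans (add_le_add h1 h2)
  · have h1 := hB i
    have h2 := hB' i
    rw [dist_eq_norm] at h1 h2 ⊢
    have e : y' i - y₀ i = (y i - y₀ i) + (y' i - y i + y₀ i - y₀ i) := by abel
    rw [e]
    exact (norm_add_le _ _).trans (add_le_add h1 h2)

variable {V : Type*} [NormedAddCommGroup V] [NormedSpace ℝ V]

/-- ★ **LOADED UNIQUENESS**: first-order strong convexity of `E` on `T` (the (X1) conclusion) makes the critical point of the LOADED energy `E − ψ`
unique in `T` for every common load `ψ` — tree YOA's `eq_of_hasFDerivAt_zero_of_strongConvexOn` applied to `E − ψ` (a linear tilt keeps the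
convexity inequality). [this file, g96] -/
theorem eq_of_hasFDerivAt_eq_of_strongConvexOn {E : V → ℝ} {T : Set V} {lam : ℝ} {D : V → V → ℝ} (hlam : 0 < lam)
    (hD : ∀ z z' : V, ‖z' - z‖ ^ 2 ≤ D z z')
    (hSC : ∀ z ∈ T, ∃ φ : V →L[ℝ] ℝ, HasFDerivAt E φ z ∧ ∀ z' ∈ T, E z + φ (z' - z) + lam * D z z' ≤ E z') (ψ : V →L[ℝ] ℝ)
    {z z' : V} (hz : z ∈ T) (hz' : z' ∈ T) (h : HasFDerivAt E ψ z) (h' : HasFDerivAt E ψ z') : z = z' := by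
  refine eq_of_hasFDerivAt_zero_of_strongConvexOn (E := fun x => E x - ψ x) (T := T) (D := D) hlam hD ?_ hz hz' ?_ ?_
  · intro x hx
    obtain ⟨φ, hφ, hsc⟩ := hSC x hx
    refine ⟨φ - ψ, hφ.sub ψ.hasFDerivAt, fun x' hx' => ?_⟩
    have hx'' := hsc x' hx'
    have hlin : ψ x' = ψ x + ψ (x' - x) := by rw [← map_add]; congr 1; abel
    simp only [FunLike.coe_sub, Pi.sub_apply]
    linarith
  · have h1 := h.sub ψ.hasFDerivAt
    rwa [sub_self] at h1
  · have h1 := h'.sub ψ.hasFDerivAt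
    rwa [sub_self] at h1

end Bookkeeping

/-! ### ZZZYN-2  The pieces (LSᴸ) `LabelLoadStepP` and (GRᴸ) `LabelGreenResponseP` (TYPED; binders of (X2ᴸ′) verbatim) -/

section Pieces

/-- ★★★ **(LSᴸ) «LabelLoadStepP … ϑ₀ Rg sb dI dB sb₁ dI₁ dB₁ ηb ηI ηB h …» — UNIFORM LOCAL LOAD-STEP SOLVABILITY IN THE INNER TUBE.**  Binders of (X2ᴸ′)
`LabelLoadedTubeAprioriP` VERBATIM up to the residual load `φ₀ = D(clampedEnergy)(lab ∘ xf)`; conclusion: for all loads `t, s ∈ [0, 1]` with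
`|s − t| ≤ h` and every critical point `z` of the loaded energy `E − (1 − t)·φ₀` lying in the `η`-SHRUNK inner tube `T(sb₁ − ηb, dI₁ − ηI, dB₁ − ηB)`
about the label image, there is a critical point `z′` of `E − (1 − s)·φ₀` whose increment `z′ − z` (re-based at the reference) lies in `T(ηb, ηI, ηB)`.
This is the LOCAL (inverse-function) half of the a-priori piece: no global confinement and no uniqueness is asserted (those come from the march of §3
and from (X1ᴸ′)).  ANALYTIC · LOCAL · INCOMPARABLE with (X2ᴸ′) as typed · UNDECIDED — its truth at given dials is the statement that the UNIFORM linear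
response to the label load over the inner tube, `Γ₁ = sup_{z ∈ T₁} ‖H(z)⁻¹ φ₀‖_tube` ((GRᴸ) below), satisfies `Γ₁·h·(1 + o(1)) ≤ η`; Newton–Kantorovich at
base `z` with step `h ≤ 1/(4 Λ_nl Γ₁)` (`Λ_nl` the Hessian–Lipschitz constant of the tube, `≈ 1.5–4.5·10³` in bond-sup units at the label patch — E2
«KANTOROVICH-SUP-96») is the intended proof.  (The outer radii `sb, dI, dB` enter only through the free-tube-reference binder.)
Why it might fail: `Γ₁·h > η` at the chosen dials (E2: `Γ₁ ≲ 1.5·10⁻³` adversarial at the tube centre, `±5 %` over the tube); a genuinely non-uniform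
Green bound over the inner tube (discrete Meyers failure at 5 % stiffness contrast — not expected).
Sources: tree YO (X2ᴸ) docstring («max-norm bound for the clamped lattice Green's operator in divergence form»); Ehrlacher–Ortner–Shapeev, Arch.
Ration. Mech. Anal. 222 (2016) (decay of discrete elastic Green's functions); Kantorovich–Akilov ch. XVIII; memo NODE-g96 §1 (E2), §2. [this file, g96] -/
def LabelLoadStepP (ϑc ϑ ϑp r rΘ q rsh ρ rm σ ϑr Rs ε rI ℓ ϑ₀ Rg sb dI dB sb₁ dI₁ dB₁ ηb ηI ηB h aHi Λ θ s : ℝ) : Prop :=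
  ∀ δ : ℝ, 0 < δ → ∀ a : ℝ, 0 < a →
    ∀ S : Set E3, IsDoorSetP aHi δ S → (∀ z : E3, Summable fun y : S => lennardJones (dist z (y : E3))) →
      (∀ p ∈ S, IsTwoShellAffineGood θ S p) →
        ∀ (L : E3 ≃L[ℝ] E3) (w : ℤ → E3), IsEquilChart a s Λ L w →
          ∀ (x₀ : E3) (K : Set E3), K ⊆ S → (∀ k ∈ K, dist k x₀ ≤ q) →
            IsTameOn ϑp S (LayeredHom (L : E3 →L[ℝ] E3) w) (coreOf S K rm) →
              IsTameOn ϑc S (LayeredHom (L : E3 →L[ℝ] E3) w) (moatIn S K r (r + rsh)) →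
                ∀ (n : ℕ) (xf : Fin n → E3), Function.Injective xf → Set.range xf = coreOf S K ρ →
                  ∀ (L' : E3 →L[ℝ] E3) (w' : ℤ → E3) (U : E3 ≃ₗᵢ[ℝ] E3) (t : E3),
                    IsCoolShadowCrystal σ ϑr Rs ε r rI ℓ S K (LayeredHom (L : E3 →L[ℝ] E3) w) L' w' U t →
                      ∀ lab : E3 → E3, IsBondLabel ε rΘ ℓ S K (placedCrystal L' w' U t) lab →
                        IsFreeTubeReference ϑ₀ ϑ Rg sb dI dB (S \ coreOf S K ρ) (LayeredHom (L : E3 →L[ℝ] E3) w) (fun i => lab (xf i)) →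
                          ∀ φ₀ : (Fin n → E3) →L[ℝ] ℝ,
                            HasFDerivAt (fun z : Fin n → E3 => clampedEnergy (S \ coreOf S K ρ) z) φ₀ (fun i => lab (xf i)) →
                              ∀ t₁ s₁ : ℝ, 0 ≤ t₁ → t₁ ≤ 1 → 0 ≤ s₁ → s₁ ≤ 1 → |s₁ - t₁| ≤ h →
                                ∀ z ∈ bondTube (S \ coreOf S K ρ) Rg (sb₁ - ηb) (dI₁ - ηI) (dB₁ - ηB) (fun i => lab (xf i)),
                                  HasFDerivAt (fun z : Fin n → E3 => clampedEnergy (S \ coreOf S K ρ) z) ((1 - t₁) • φ₀) z →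
                                    ∃ z' : Fin n → E3,
                                      (fun i => z' i - z i + lab (xf i)) ∈ bondTube (S \ coreOf S K ρ) Rg ηb ηI ηB (fun i => lab (xf i)) ∧
                                        HasFDerivAt (fun z : Fin n → E3 => clampedEnergy (S \ coreOf S K ρ) z) ((1 - s₁) • φ₀) z'

/-- ★★★ **(GRᴸ) «LabelGreenResponseP … ϑ₀ Rg sb dI dB sb₁ dI₁ dB₁ Γb ΓI ΓB …» — THE UNIFORM LINEAR RESPONSE BOUND FOR THE LABEL LOAD OVER THE INNER TUBE.**
Binders of (X2ᴸ′) VERBATIM up to `φ₀`; conclusion: at every member `z` of the inner tube the linearised problem «`H(z) u = φ₀`» — `H(z)` the clamped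
pre-stressed Hessian form `clampedHessForm (S ∖ core) z` (tree ZZZYJ), POLARISED, so no operator inverse is named — has a solution `u` whose re-based
image `u + lab ∘ xf` lies in `T(Γb, ΓI, ΓB)`: bond deviations of the response `≤ Γb` on the `Rg`-pairs, interface pin `≤ ΓI`, bulk pin `≤ ΓB`.  This is
the object the desk line E2 computes (at `z = lab ∘ xf`: adversarial `Γb ≤ 1.5·10⁻³`, `ΓI ≤ 8·10⁻⁴` at `ε = ϑr = 10⁻⁴`, memo §1) and the typed home of
the critic's «E2-AFF»: its proof is NOT `‖H⁻¹‖_{∞→∞}·‖φ₀‖_∞` (which fails by 17–50×) but the decomposition of `φ₀` into the SEAM-SUPPORTED incoherent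
`ε`-mismatch (local response), the LAYER-TELESCOPING offset residual of the shadow crystal (a one-dimensional response — homogeneous strains and
translations of a layered crystal are force-free up to exactly this telescoping field; for a non-Bravais stacking the inner displacement is NOT
reproduced exactly, so «affine exactness» holds only modulo it) and the `r⁻⁴` far field.  ANALYTIC · LINEAR · UNDECIDED(E2) · not consumed by the
glue of this file ((LSᴸ) ⟸ (GRᴸ) ∧ chord calculus ∧ Hessian–Lipschitz is the next node).
Why it might fail: an admissible shadow crystal / exterior pair whose structured response exceeds `Γb` (E2's adversarial bound has margin ≈ 1.7 at
the softest conformal corner against `1/400`); loss of uniformity over the tube.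
Sources: tree ZZZYJ (`clampedHessForm`, `bondHess`), tree YO (X2ᴸ) docstring, memo NODE-g96 §1; Ehrlacher–Ortner–Shapeev (2016). [this file, g96] -/
def LabelGreenResponseP (ϑc ϑ ϑp r rΘ q rsh ρ rm σ ϑr Rs ε rI ℓ ϑ₀ Rg sb dI dB sb₁ dI₁ dB₁ Γb ΓI ΓB aHi Λ θ s : ℝ) : Prop :=
  ∀ δ : ℝ, 0 < δ → ∀ a : ℝ, 0 < a →
    ∀ S : Set E3, IsDoorSetP aHi δ S → (∀ z : E3, Summable fun y : S => lennardJones (dist z (y : E3))) →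
      (∀ p ∈ S, IsTwoShellAffineGood θ S p) →
        ∀ (L : E3 ≃L[ℝ] E3) (w : ℤ → E3), IsEquilChart a s Λ L w →
          ∀ (x₀ : E3) (K : Set E3), K ⊆ S → (∀ k ∈ K, dist k x₀ ≤ q) →
            IsTameOn ϑp S (LayeredHom (L : E3 →L[ℝ] E3) w) (coreOf S K rm) →
              IsTameOn ϑc S (LayeredHom (L : E3 →L[ℝ] E3) w) (moatIn S K r (r + rsh)) →
                ∀ (n : ℕ) (xf : Fin n → E3), Function.Injective xf → Set.range xf = coreOf S K ρ →
                  ∀ (L' : E3 →L[ℝ] E3) (w' : ℤ → E3) (U : E3 ≃ₗᵢ[ℝ] E3) (t : E3),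
                    IsCoolShadowCrystal σ ϑr Rs ε r rI ℓ S K (LayeredHom (L : E3 →L[ℝ] E3) w) L' w' U t →
                      ∀ lab : E3 → E3, IsBondLabel ε rΘ ℓ S K (placedCrystal L' w' U t) lab →
                        IsFreeTubeReference ϑ₀ ϑ Rg sb dI dB (S \ coreOf S K ρ) (LayeredHom (L : E3 →L[ℝ] E3) w) (fun i => lab (xf i)) →
                          ∀ φ₀ : (Fin n → E3) →L[ℝ] ℝ,
                            HasFDerivAt (fun z : Fin n → E3 => clampedEnergy (S \ coreOf S K ρ) z) φ₀ (fun i => lab (xf i)) →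
                              ∀ z ∈ bondTube (S \ coreOf S K ρ) Rg sb₁ dI₁ dB₁ (fun i => lab (xf i)),
                                ∃ u : Fin n → E3,
                                  (fun i => u i + lab (xf i)) ∈ bondTube (S \ coreOf S K ρ) Rg Γb ΓI ΓB (fun i => lab (xf i)) ∧
                                    ∀ v : Fin n → E3,
                                      clampedHessForm (S \ coreOf S K ρ) z (u + v) - clampedHessForm (S \ coreOf S K ρ) z u -
                                          clampedHessForm (S \ coreOf S K ρ) z v = 2 * φ₀ v

end Pieces

/-! ### ZZZYN-3  The glue: (X1ᴸ′)(lam > 0) ∧ (LSᴸ)(h = 1/m) ⟹ (X2ᴸ′) by an `m`-step march and loaded uniqueness (PROVED) -/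

section Glue

variable {ϑc ϑ ϑp r rΘ q rsh ρ rm σ ϑr Rs ε rI ℓ ϑ₀ Rg sb dI dB sb₁ dI₁ dB₁ ηb ηI ηB lam aHi Λ θ s : ℝ}

/-- ★★★ **THE LOAD-STEP GLUE (PROVED): (X1ᴸ′)(lam > 0) ∧ (LSᴸ)(step `1/m`, increment radii `η`) ⟹ (X2ᴸ′)(inner radii `sb₁, dI₁, dB₁`)** whenever
`(m + 1)·η ≤` inner radii `≤` outer radii and `η ≥ 0`.  March: `z₀ := lab ∘ xf` is critical at load `t = 0` (its load IS `φ₀`); (LSᴸ) moves load `k/m ↦ (k+1)/m`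
keeping `z_k ∈ T(k·η)` (`bondTube_step`), `k ≤ m`; for a given load `t₁` one more step from `z_⌊t₁ m⌋` reaches a critical point in `T((⌊t₁ m⌋ + 1)·η) ⊆ T₁`;
(X1ᴸ′) makes loaded critical points unique in the outer tube (`eq_of_hasFDerivAt_eq_of_strongConvexOn`), so the given one IS it. [this file, g96] -/
theorem labelLoadedTubeAprioriP_of_loadStep {m : ℕ} (hm : 0 < m) (hlam : 0 < lam)
    (hηb : 0 ≤ ηb) (hηI : 0 ≤ ηI) (hηB : 0 ≤ ηB)
    (hmb : (m + 1 : ℝ) * ηb ≤ sb₁) (hmI : (m + 1 : ℝ) * ηI ≤ dI₁) (hmB : (m + 1 : ℝ) * ηB ≤ dB₁)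
    (hsb : sb₁ ≤ sb) (hdI : dI₁ ≤ dI) (hdB : dB₁ ≤ dB)
    (hC : LabelTubeConvexityP ϑc ϑ ϑp r rΘ q rsh ρ rm σ ϑr Rs ε rI ℓ ϑ₀ Rg sb dI dB lam aHi Λ θ s)
    (hL : LabelLoadStepP ϑc ϑ ϑp r rΘ q rsh ρ rm σ ϑr Rs ε rI ℓ ϑ₀ Rg sb dI dB sb₁ dI₁ dB₁ ηb ηI ηB (1 / m) aHi Λ θ s) :
    LabelLoadedTubeAprioriP ϑc ϑ ϑp r rΘ q rsh ρ rm σ ϑr Rs ε rI ℓ ϑ₀ Rg sb dI dB sb₁ dI₁ dB₁ aHi Λ θ s := by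
  intro δ hδ a ha S hS hsum hgood L w hLw x₀ K hKS hKq hmild hcool n xf hxf hrange L' w' U t hCr lab hlab hy₀ φ₀ hφ₀ t₁ ht₀ ht₁ z hz hzc
  have hSC := hC δ hδ a ha S hS hsum hgood L w hLw x₀ K hKS hKq hmild hcool n xf hxf hrange L' w' U t hCr lab hlab hy₀
  have hLS := hL δ hδ a ha S hS hsum hgood L w hLw x₀ K hKS hKq hmild hcool n xf hxf hrange L' w' U t hCr lab hlab hy₀ φ₀ hφ₀
  set X : Set E3 := S \ coreOf S K ρ with hXdef
  set y₀ : Fin n → E3 := fun i => lab (xf i) with hy₀def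
  set E : (Fin n → E3) → ℝ := fun z => clampedEnergy X z with hEdef
  have hm' : (0 : ℝ) < m := by exact_mod_cast hm
  have hm1 : (m : ℝ) * ηb ≤ sb₁ - ηb := by nlinarith
  have hm2 : (m : ℝ) * ηI ≤ dI₁ - ηI := by nlinarith
  have hm3 : (m : ℝ) * ηB ≤ dB₁ - ηB := by nlinarith
  -- one load step from a member of T(k η), k ≤ m, at load t to load s
  have hstep : ∀ (k : ℝ), k ≤ m → ∀ t s : ℝ, 0 ≤ t → t ≤ 1 → 0 ≤ s → s ≤ 1 → |s - t| ≤ 1 / (m : ℝ) →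
      ∀ zk : Fin n → E3, zk ∈ bondTube X Rg (k * ηb) (k * ηI) (k * ηB) y₀ → HasFDerivAt E ((1 - t) • φ₀) zk →
        ∃ z' : Fin n → E3, z' ∈ bondTube X Rg ((k + 1) * ηb) ((k + 1) * ηI) ((k + 1) * ηB) y₀ ∧ HasFDerivAt E ((1 - s) • φ₀) z' := by
    intro k hk t s ht ht' hs hs' hst zk hzk hzkc
    have hzk' : zk ∈ bondTube X Rg (sb₁ - ηb) (dI₁ - ηI) (dB₁ - ηB) y₀ :=
      bondTube_mono ((mul_le_mul_of_nonneg_right hk hηb).trans hm1) ((mul_le_mul_of_nonneg_right hk hηI).trans hm2)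
        ((mul_le_mul_of_nonneg_right hk hηB).trans hm3) hzk
    obtain ⟨z', hd, hz'c⟩ := hLS t s ht ht' hs hs' hst zk hzk' hzkc
    refine ⟨z', ?_, hz'c⟩
    have h := bondTube_step hzk hd
    have e1 : k * ηb + ηb = (k + 1) * ηb := by ring
    have e2 : k * ηI + ηI = (k + 1) * ηI := by ring
    have e3 : k * ηB + ηB = (k + 1) * ηB := by ring
    rw [e1, e2, e3] at h
    exact h
  -- the march: for every k ≤ m a loaded critical point at load k/m in T(k η)
  have hmarch : ∀ k : ℕ, k ≤ m → ∃ zk : Fin n → E3,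
      zk ∈ bondTube X Rg ((k : ℝ) * ηb) ((k : ℝ) * ηI) ((k : ℝ) * ηB) y₀ ∧ HasFDerivAt E ((1 - (k : ℝ) / m) • φ₀) zk := by
    intro k
    induction k with
    | zero =>
      intro _
      refine ⟨y₀, ?_, ?_⟩
      · simpa using (self_mem_bondTube (X := X) (Rg := Rg) (y₀ := y₀) le_rfl le_rfl le_rfl)
      · simpa using hφ₀
    | succ k ih =>
      intro hk1
      obtain ⟨zk, hzk, hzkc⟩ := ih (Nat.le_of_succ_le hk1)
      have hk : (k : ℝ) ≤ m := by exact_mod_cast Nat.le_of_succ_le hk1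
      have hk1' : ((k : ℝ) + 1) ≤ m := by exact_mod_cast hk1
      have ht : 0 ≤ (k : ℝ) / m := by positivity
      have ht' : (k : ℝ) / m ≤ 1 := by rw [div_le_one hm']; exact hk
      have hs : 0 ≤ ((k : ℝ) + 1) / m := by positivity
      have hs' : ((k : ℝ) + 1) / m ≤ 1 := by rw [div_le_one hm']; exact hk1'
      have hst : |((k : ℝ) + 1) / m - (k : ℝ) / m| ≤ 1 / (m : ℝ) := by
        rw [← sub_div, abs_div, abs_of_pos hm']
        have : (k : ℝ) + 1 - k = 1 := by ring
        rw [this, abs_one]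
      obtain ⟨z', hz', hz'c⟩ := hstep k hk _ _ ht ht' hs hs' hst zk hzk hzkc
      refine ⟨z', ?_, ?_⟩
      · simpa [Nat.cast_succ] using hz'
      · simpa [Nat.cast_succ] using hz'c
  -- the given load t₁: one more step from z_⌊t₁ m⌋
  set k : ℕ := ⌊t₁ * m⌋₊ with hkdef
  have htm : 0 ≤ t₁ * m := by positivity
  have hkle : (k : ℝ) ≤ t₁ * m := Nat.floor_le htm
  have hklt : t₁ * m < (k : ℝ) + 1 := Nat.lt_floor_add_one (t₁ * m)
  have hkm : k ≤ m := by
    have : (k : ℝ) ≤ m := hkle.trans (by nlinarith)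
    exact_mod_cast this
  obtain ⟨zk, hzk, hzkc⟩ := hmarch k hkm
  have hk : (k : ℝ) ≤ m := by exact_mod_cast hkm
  have ht : 0 ≤ (k : ℝ) / m := by positivity
  have ht' : (k : ℝ) / m ≤ 1 := by rw [div_le_one hm']; exact hk
  have hst : |t₁ - (k : ℝ) / m| ≤ 1 / (m : ℝ) := by
    rw [abs_le]
    constructor
    · have h1 : (k : ℝ) / m ≤ t₁ := by rw [div_le_iff₀ hm']; exact hkle
      have h2 : 0 < 1 / (m : ℝ) := by positivity
      linarith
    · have h1 : t₁ < ((k : ℝ) + 1) / m := by rw [lt_div_iff₀ hm']; exact hklt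
      have h2 : ((k : ℝ) + 1) / m = (k : ℝ) / m + 1 / m := by rw [add_div]
      linarith
  obtain ⟨z'', hz'', hz''c⟩ := hstep k hk _ t₁ ht ht' ht₀ ht₁ hst zk hzk hzkc
  -- z'' lies in the inner tube, hence in the outer tube
  have hk1 : (k : ℝ) + 1 ≤ m + 1 := by linarith
  have hT₁ : z'' ∈ bondTube X Rg sb₁ dI₁ dB₁ y₀ :=
    bondTube_mono ((mul_le_mul_of_nonneg_right hk1 hηb).trans hmb) ((mul_le_mul_of_nonneg_right hk1 hηI).trans hmI)
      ((mul_le_mul_of_nonneg_right hk1 hηB).trans hmB) hz''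
  have hT : z'' ∈ bondTube X Rg sb dI dB y₀ := bondTube_mono hsb hdI hdB hT₁
  -- loaded uniqueness on the outer tube: the given critical point is z''
  have heq : z = z'' :=
    eq_of_hasFDerivAt_eq_of_strongConvexOn (E := E) (T := bondTube X Rg sb dI dB y₀)
      (D := fun z z' : Fin n → E3 => ∑ i, dist (z i) (z' i) ^ 2) hlam (fun z z' => norm_sub_sq_le_sum_dist_sq z z') hSC ((1 - t₁) • φ₀)
      hz hT hzc hz''c
  rw [heq]
  exact hT₁

end Glue

/-! ### ZZZYN-4  The door W2n at the record dials and a dial example -/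

section Door

/-- ★★ **THE DOOR W2n**: `ϑc ≤ 5·10⁻¹²`, (X1ᴸ′)(lam > 0), (LSᴸ)(step `1/m`, increments `η`), (KAᴸ′), (QL♯ᴸ′)(c > 0), (OGʰ′⋆)(g₀ > 0) — with the inner radii
`sb₁, dI₁, dB₁` FREE subject to `(m+1)·η ≤` inner radii and the W2m ceilings `4 sb₁, 4 dI₁ ≤ 249/5000`, `dB₁ ≤ 2/5` — ⟹ `[MCMC♮](ϑc)`.  Door W2m with
its (X2ᴸ′) hypothesis discharged by `labelLoadedTubeAprioriP_of_loadStep`. [this file, g96] -/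
theorem mildCoherentMoatCorePG_W2n {ϑc sb₁ dI₁ dB₁ sbp dIp dBp ηb ηI ηB lam c g₀ : ℝ} {m : ℕ} (hm : 0 < m)
    (hϑc : ϑc ≤ 1 / 200000000000) (hlam : 0 < lam) (hc : 0 < c) (hg₀ : 0 < g₀)
    (hsb : 4 * sb₁ ≤ 249 / 5000) (hdI : 4 * dI₁ ≤ 249 / 5000) (hdB : dB₁ ≤ 2 / 5)
    (hηb : 0 ≤ ηb) (hηI : 0 ≤ ηI) (hηB : 0 ≤ ηB)
    (hmb : (m + 1 : ℝ) * ηb ≤ sb₁) (hmI : (m + 1 : ℝ) * ηI ≤ dI₁) (hmB : (m + 1 : ℝ) * ηB ≤ dB₁)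
    (hX1 : LabelTubeConvexityP ϑc tameRadius (1 / 10) 8 (145 / 16) 4 12 16 16 (27 / 32) (1 / 10000) 5 (1 / 10000) 10 (43 / 2) (1 / 5000) (121 / 25)
      (249 / 5000) (249 / 5000) (21 / 50) lam 1 2 (1 / 16) (1 / 50))
    (hLS : LabelLoadStepP ϑc tameRadius (1 / 10) 8 (145 / 16) 4 12 16 16 (27 / 32) (1 / 10000) 5 (1 / 10000) 10 (43 / 2) (1 / 5000) (121 / 25)
      (249 / 5000) (249 / 5000) (21 / 50) sb₁ dI₁ dB₁ ηb ηI ηB (1 / m) 1 2 (1 / 16) (1 / 50))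
    (hKA : SoftCaptureP ϑc (1 / 10) 8 (145 / 16) 4 12 16 16 (27 / 32) (1 / 10000) 5 (1 / 10000) 10 (43 / 2) (121 / 25) sb₁ dI₁ dB₁ sbp dIp dBp
      (121 / 25) (249 / 10000) 1 2 (1 / 16) (1 / 50))
    (hQS : SoftLedgerSharpP ϑc tameRadius (1 / 10) 8 (145 / 16) 4 12 16 16 (27 / 32) (1 / 10000) 5 (1 / 10000) 10 (43 / 2) (121 / 25) sb₁ dI₁ dB₁
      sbp dIp dBp (121 / 25) (249 / 10000) c 1 2 (1 / 16) (1 / 50))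
    (hH : OffTubeHardGapMinP ϑc tameRadius (1 / 10) 8 (145 / 16) 4 12 16 16 (27 / 32) (1 / 10000) 5 (1 / 10000) 10 (43 / 2) (121 / 25) (249 / 5000)
      (249 / 5000) (21 / 50) sb₁ dI₁ dB₁ (121 / 25) (249 / 10000) g₀ 1 2 (1 / 16) (1 / 50)) :
    MildCoherentMoatCorePG ϑc tameRadius (1 / 10) 8 4 12 16 1 2 (1 / 16) (1 / 50) := by
  have hm' : (0 : ℝ) < m := by exact_mod_cast hm
  have hsb₀ : 0 ≤ sb₁ := le_trans (by positivity) hmb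
  have hdI₀ : 0 ≤ dI₁ := le_trans (by positivity) hmI
  have hdB₀ : 0 ≤ dB₁ := le_trans (by positivity) hmB
  exact mildCoherentMoatCorePG_W2m hϑc hlam hc hg₀ hsb hdI hdB hsb₀ hdI₀ hdB₀ hX1
    (labelLoadedTubeAprioriP_of_loadStep hm hlam hηb hηI hηB hmb hmI hmB (by linarith) (by linarith) (by linarith) hX1 hLS) hKA hQS hH

/-- **DIAL EXAMPLE** (E2's reading, memo §1): `m = 24` load steps of increment radius `η = 10⁻⁴` each — so the supplied inner tube is
`(sb₁, dI₁, dB₁) = (1/400, 1/400, 1/400)`, the SB1-PIN-95 pass line of the sharp ledger — satisfy every arithmetic side condition of door W2n.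
[this file, g96] -/
example : (0 : ℕ) < 24 ∧ (4 : ℝ) * (1 / 400) ≤ 249 / 5000 ∧ (1 / 400 : ℝ) ≤ 2 / 5 ∧ (0 : ℝ) ≤ 1 / 10000 ∧
    ((24 : ℕ) + 1 : ℝ) * (1 / 10000) ≤ 1 / 400 := by
  refine ⟨by norm_num, by norm_num, by norm_num, by norm_num, by norm_num⟩

end Door

end Summit.AtomisticToContinuum.Crystallization.Theorems.ChartedZeroExcessLayeredLatticeLiouville
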